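import Mathlib

/-!
# T5PeriodTransport — the transport of the second toric period (Tier-5 sub-step N2, row N2.2.12)

Row N2.2.12 of route/T5-N2-route-3.md reads: «`F^g(h) := F(g h g⁻¹)` automorphic; change of
variables on compact quotients ⟹ `P_{Λ_B}(F) = P_{Λ_B^g}(F^g)`», with `T_B = g T_A g⁻¹`
(`g T_A g⁻¹ = T_B` of row N2.2.11) and `Λ_B^g = Λ_B ∘ Ad(g)`.  This file is the kernel witness
of that change of variables, in the generality in which it is true:

* `period μ F Λ := ∫ F(t) Λ(t) dμ(t)` is the toric period of a function `F` against a
  character `Λ` for a measure `μ` on the (compact) torus;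
* `conjSubgroup g H = g H g⁻¹` (Mathlib's `H.map (MulAut.conj g : G →* G)`), `adEquiv g H :
  H ≃* g H g⁻¹` is `Ad(g)` (Mathlib's `MulEquiv.subgroupMap`), a homeomorphism (`adHomeomorph`)
  and a measurable equivalence (`adMeasurableEquiv`) for a topological group with its Borel
  σ-algebra;
* `map_eq_of_isHaarMeasure`: the push-forward of a Haar PROBABILITY measure under a bicontinuous
  isomorphism of groups is THE Haar probability measure of the target (uniqueness,
  Mathlib's `isHaarMeasure_eq_of_isProbabilityMeasure`) — this is the «change of variables on
  compact quotients»;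
* `period_transport` / **`period_conj`**: `P_{Λ}(F)` over `g H g⁻¹` (Haar probability) equals
  `P_{Λ ∘ Ad(g)}(F^g)` over `H` (Haar probability), `F^g(h) = F(g h g⁻¹)` (`conjForm`);
* `conjForm_left_invariant`: if `F` is left-invariant under `Γ`, then `F^g` is left-invariant
  under `g⁻¹ Γ g` — the «`F^g` automorphic» of the row, at the level of invariance.
  Membership / Hecke-side properties of the conjugate subgroup itself are not restated here
  (they are p8's level-conjugation file's business).

The compact torus `T_A(F⁺)\T_A(𝔸)` of the record is the compact group `H` here; that the
toric period of the record is this integral, and that the rational element `g` of N2.2.11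
conjugates one torus onto the other, are the record's identifications (prose).  No Literature
fact is asserted.
-/

namespace Summit.Ventures.HodgeRepro2.T5PeriodTransport

open MeasureTheory Measure

/-! ## 1. The toric period and its behaviour under a measurable equivalence -/

section Period

variable {T : Type*} [MeasurableSpace T]

/-- The toric period `P_Λ(F) := ∫_T F(t) Λ(t) dμ(t)`. -/
noncomputable def period (μ : Measure T) (F Λ : T → ℂ) : ℂ := ∫ t, F t * Λ t ∂μ

/-- Change of variables along a measurable equivalence `e : T ≃ᵐ T'`: the period for the
push-forward measure is the period of the pulled-back data (Mathlib's `integral_map_equiv`). -/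
theorem period_map_equiv {T' : Type*} [MeasurableSpace T'] (μ : Measure T) (e : T ≃ᵐ T')
    (F Λ : T' → ℂ) : period (μ.map e) F Λ = period μ (F ∘ e) (Λ ∘ e) := by
  unfold period
  exact integral_map_equiv e (fun t => F t * Λ t)

/-- The period is linear in `F`: scaling. -/
theorem period_smul (μ : Measure T) (c : ℂ) (F Λ : T → ℂ) :
    period μ (fun t => c * F t) Λ = c * period μ F Λ := by
  unfold period
  simp only [mul_assoc]
  exact integral_const_mul c _

end Period

/-! ## 2. Conjugation of a subgroup: `Ad(g) : H ≃* g H g⁻¹` -/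

section Conjugation

variable {G : Type*} [Group G]

/-- The conjugate subgroup `g H g⁻¹`. -/
abbrev conjSubgroup (g : G) (H : Subgroup G) : Subgroup G := H.map (MulAut.conj g : G →* G)

/-- The conjugation isomorphism `Ad(g) : H ≃* g H g⁻¹`, `h ↦ g h g⁻¹`. -/
def adEquiv (g : G) (H : Subgroup G) : H ≃* conjSubgroup g H :=
  (MulAut.conj g).subgroupMap H

/-- `Ad(g) h = g h g⁻¹` (as elements of `G`). -/
@[simp] theorem coe_adEquiv_apply (g : G) (H : Subgroup G) (h : H) :
    (adEquiv g H h : G) = g * h * g⁻¹ := by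
  simp [adEquiv]

/-- `Ad(g)⁻¹ x = g⁻¹ x g` (as elements of `G`). -/
@[simp] theorem coe_adEquiv_symm_apply (g : G) (H : Subgroup G) (x : conjSubgroup g H) :
    ((adEquiv g H).symm x : G) = g⁻¹ * x * g := by
  obtain ⟨h, hh⟩ := (adEquiv g H).surjective x
  subst hh
  simp [mul_assoc]

/-- `F^g(h) := F(g h g⁻¹)` — the conjugate of a function on `G`. -/
def conjForm (g : G) (F : G → ℂ) : G → ℂ := fun h => F (g * h * g⁻¹)

/-- `F^g(h) = F(g h g⁻¹)`. -/
@[simp] theorem conjForm_apply (g : G) (F : G → ℂ) (h : G) : conjForm g F h = F (g * h * g⁻¹) :=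
  rfl

/-- `F ∘ Ad(g) = F^g` on `H`. -/
theorem comp_adEquiv (g : G) (H : Subgroup G) (F : G → ℂ) :
    (F ∘ Subtype.val) ∘ adEquiv g H = conjForm g F ∘ (Subtype.val : H → G) := by
  funext h
  simp [conjForm]

/-- «`F^g` automorphic»: if `F` is left-invariant under `Γ`, then `F^g` is left-invariant under
the conjugates `g⁻¹ γ g`, `γ ∈ Γ` — i.e. under `g⁻¹ Γ g`. -/
theorem conjForm_left_invariant (g : G) (Γ : Subgroup G) (F : G → ℂ)
    (hF : ∀ γ ∈ Γ, ∀ x, F (γ * x) = F x) :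
    ∀ γ ∈ Γ, ∀ x, conjForm g F (g⁻¹ * γ * g * x) = conjForm g F x := by
  intro γ hγ x
  have : g * (g⁻¹ * γ * g * x) * g⁻¹ = γ * (g * x * g⁻¹) := by group
  simp only [conjForm_apply, this]
  exact hF γ hγ _

end Conjugation

/-! ## 3. Topology and measurability of `Ad(g)` -/

section Topological

variable {G : Type*} [Group G] [TopologicalSpace G] [IsTopologicalGroup G]

/-- `Ad(g) : H → g H g⁻¹` is continuous. -/
theorem continuous_adEquiv (g : G) (H : Subgroup G) : Continuous (adEquiv g H) := by
  apply continuous_induced_rng.2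
  exact (continuous_const.mul continuous_subtype_val).mul continuous_const

/-- `Ad(g)⁻¹ : g H g⁻¹ → H` is continuous. -/
theorem continuous_adEquiv_symm (g : G) (H : Subgroup G) :
    Continuous (adEquiv g H).symm := by
  apply continuous_induced_rng.2
  have : (Subtype.val ∘ (adEquiv g H).symm) = fun x : conjSubgroup g H => g⁻¹ * (x : G) * g := by
    funext x
    exact coe_adEquiv_symm_apply g H x
  rw [this]
  exact (continuous_const.mul continuous_subtype_val).mul continuous_const

/-- `Ad(g)` as a homeomorphism `H ≃ₜ g H g⁻¹`. -/
def adHomeomorph (g : G) (H : Subgroup G) : H ≃ₜ conjSubgroup g H where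
  toEquiv := (adEquiv g H).toEquiv
  continuous_toFun := continuous_adEquiv g H
  continuous_invFun := continuous_adEquiv_symm g H

/-- The homeomorphism acts as `Ad(g)`. -/
@[simp] theorem adHomeomorph_apply (g : G) (H : Subgroup G) (h : H) :
    adHomeomorph g H h = adEquiv g H h := rfl

/-- `g H g⁻¹` is compact when `H` is. -/
theorem compactSpace_conjSubgroup (g : G) (H : Subgroup G) [CompactSpace H] :
    CompactSpace (conjSubgroup g H) :=
  (adHomeomorph g H).compactSpace

variable [MeasurableSpace G] [BorelSpace G]

/-- `Ad(g)` as a measurable equivalence `H ≃ᵐ g H g⁻¹` (Borel σ-algebras). -/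
def adMeasurableEquiv (g : G) (H : Subgroup G) : H ≃ᵐ conjSubgroup g H :=
  (adHomeomorph g H).toMeasurableEquiv

/-- The measurable equivalence acts as `Ad(g)`. -/
@[simp] theorem adMeasurableEquiv_apply (g : G) (H : Subgroup G) (h : H) :
    adMeasurableEquiv g H h = adEquiv g H h := rfl

end Topological

/-! ## 4. Haar probability measures are transported to Haar probability measures -/

section Haar

variable {T T' : Type*} [Group T] [TopologicalSpace T] [IsTopologicalGroup T] [MeasurableSpace T]
  [BorelSpace T] [Group T'] [TopologicalSpace T'] [IsTopologicalGroup T'] [MeasurableSpace T']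
  [BorelSpace T'] [LocallyCompactSpace T']

/-- **Change of variables on compact quotients, the measure side:** the push-forward of a Haar
probability measure under a bicontinuous isomorphism of groups is a Haar probability measure,
hence (uniqueness) THE Haar probability measure of the target. -/
theorem map_eq_of_isHaarMeasure (μ : Measure T) [μ.IsHaarMeasure] [IsProbabilityMeasure μ]
    (μ' : Measure T') [μ'.IsHaarMeasure] [IsProbabilityMeasure μ'] (e : T ≃* T')
    (he : Continuous e) (hes : Continuous e.symm) : μ.map e = μ' := by
  haveI : (μ.map e).IsHaarMeasure := MulEquiv.isHaarMeasure_map μ e he hes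
  haveI : IsProbabilityMeasure (μ.map e) := isProbabilityMeasure_map he.measurable.aemeasurable
  exact isHaarMeasure_eq_of_isProbabilityMeasure _ _

/-- **Change of variables on compact quotients, the period side:** for Haar probability
measures `μ` on `T` and `μ'` on `T'` and a bicontinuous isomorphism `e : T ≃* T'`,
`P_Λ(F)` over `T'` equals `P_{Λ ∘ e}(F ∘ e)` over `T`. -/
theorem period_transport (μ : Measure T) [μ.IsHaarMeasure] [IsProbabilityMeasure μ]
    (μ' : Measure T') [μ'.IsHaarMeasure] [IsProbabilityMeasure μ'] (e : T ≃* T')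
    (he : Continuous e) (hes : Continuous e.symm) (F Λ : T' → ℂ) :
    period μ' F Λ = period μ (F ∘ e) (Λ ∘ e) := by
  let eh : T ≃ₜ T' :=
    { toEquiv := e.toEquiv
      continuous_toFun := he
      continuous_invFun := hes }
  have h1 : μ.map e = μ' := map_eq_of_isHaarMeasure μ μ' e he hes
  have h2 := period_map_equiv μ eh.toMeasurableEquiv F Λ
  have h3 : (⇑eh.toMeasurableEquiv : T → T') = ⇑e := rfl
  rw [h3, h1] at h2
  exact h2

end Haar

/-! ## 5. Row N2.2.12 assembled -/

section Row

variable {G : Type*} [Group G] [TopologicalSpace G] [IsTopologicalGroup G]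
  [MeasurableSpace G] [BorelSpace G]

/-- **Row N2.2.12:** for a compact subgroup `H = T_A` of a topological group `G`, the element
`g` with `T_B = g H g⁻¹`, Haar probability measures `μA` on `T_A` and `μB` on `T_B`, a
function `F` on `G` and a character `Λ` of `T_B`:
`P_Λ(F|_{T_B}) = P_{Λ ∘ Ad(g)}(F^g|_{T_A})` with `F^g(h) = F(g h g⁻¹)`. -/
theorem period_conj (g : G) (H : Subgroup G) [CompactSpace H]
    (μA : Measure H) [μA.IsHaarMeasure] [IsProbabilityMeasure μA]
    (μB : Measure (conjSubgroup g H)) [μB.IsHaarMeasure] [IsProbabilityMeasure μB]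
    (F : G → ℂ) (Λ : conjSubgroup g H → ℂ) :
    period μB (F ∘ Subtype.val) Λ =
      period μA (conjForm g F ∘ (Subtype.val : H → G)) (Λ ∘ adEquiv g H) := by
  haveI : CompactSpace (conjSubgroup g H) := compactSpace_conjSubgroup g H
  have h := period_transport μA μB (adEquiv g H) (continuous_adEquiv g H)
    (continuous_adEquiv_symm g H) (F ∘ Subtype.val) Λ
  rw [comp_adEquiv] at h
  exact h

end Row

end Summit.Ventures.HodgeRepro2.T5PeriodTransport
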